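import Summits.MatrixMultiplication.OmegaCensus.Z4Z4DominoFiveTables
import Summits.MatrixMultiplication.OmegaCensus.DominoPartThreeZ4Z4
import HarnessLib

/-!
# No domino cube law triple with a part of size `5` over `A ↠ ℤ₄ × ℤ₄`

ω-census `pub-omega`, family (b3), seat pub-omega-group gen 15.  Framing: lottery ticket; floor = certified bounds/negative
ranges.  VALUE: a kernel theorem about the group-theoretic method (TPP capacity of dihedral-like groups) closing an infinite
column of census cells; NOT progress on ω.

**Theorem (`no_law_cube_15e_of_onto_z4z4`, `no_law_cube_1d5_of_onto_z4z4`).** Let `G` be dihedral-like over a finite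
abelian group `A` (presentation `ρ, τ : A → G`, ANY `c₀`) and suppose `A` maps onto `ZMod 4 × ZMod 4`.  Then no TPP triple
with coset parts of sizes `(1,1 | 5,5 | e,e)` or `(1,1 | d,d | 5,5)` attains the law `3|S||T||U| + 8 = 8|A|`.

Census use: the Dih-side cells `(1,5,17)` over `ℤ₄×ℤ₆₄`, `ℤ₈×ℤ₃₂`, `ℤ₁₆²` (`|A| = 256`, NR68, hitherto engine ×2),
`(1,5,33)` at `496`, `(1,5,49)` at `736`, `(1,5,65)` at `976` (engine ×1), and `(1,5,e)` over every `A` of `2`-rank `2` with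
both `2`-exponents `≥ 2`.

*Proof* (gen 14's method for part `3`, with a two-character table found by exact enumeration).  `domino_shifted_form_of_law`
gives `X` (`|X| = 5`), `Y`, `β, γ, x₀` with `(X+Y) ⊔ (β+(Y−X)) ⊔ (γ+(X−Y)) = A∖{x₀}`; for every character `ψ = ψ_w` pulled
back from `ℤ₄²`, `a b + ψ(β) ā b + ψ(γ) a b̄ = −ψ(x₀)` (`a = ψ(X)`, `b = ψ(Y)`).  By pigeonhole two points `x₁, x₂ ∈ X` agree
mod `2ℤ₄²`; translating by `x₁` (`a = ψ(x₁)·a₀`, `β' = β − 2x₁`) the identity keeps its shape.  Real characters: `a₀ = ±1`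
(a real `a₀ ∈ {±3, ±5}` would divide a unit), so the other three points `y₃, y₄, y₅` have at least two `−1`'s under each
real character (`pattern5`: classes `01 | 10 | 11` in coordinates `w, w'` dual to `(φβ', φγ)`, which form a basis mod `2`
because `(ψβ', ψγ) ≠ (1,1)` for real `ψ`).  For the characters `w` and `w + 2w'` one has `ψβ' = i`, `ψγ = ±1`, and
eliminating `b̄` gives `D b = N` with an integer `D`; the table `table5` (`Z4Z4DominoFiveTables.lean`) shows that for one of
the two characters `N` is not divisible by `D` (`false_of_kill5`).  ∎
-/

namespace Summit.MatrixMultiplication.OmegaCensus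

open Finset

/-! ## The normalised endgame -/

/-- **Endgame.**  Normalised exponent data `(m, n)` of `x₂ − x₁, y₃ − x₁, y₄ − x₁, y₅ − x₁` in coordinates `w, w'`, with
`2m₂ = 2n₂ = 0` and classes `01 | 10 | 11`, the two identities for the characters `w` (`ψβ' = i`, `ψγ = 1`) and `w + 2w'`
(`ψβ' = i`, `ψγ = −1`): contradiction (`table5` + `false_of_kill5`). [folklore] -/
theorem finish5 (m₂ m₃ m₄ m₅ n₂ n₃ n₄ n₅ l₁ l₂ : ZMod 4) (a₁ a₂ b₁ b₂ : GaussianInt)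
    (h2m₂ : 2 * m₂ = 0) (h2n₂ : 2 * n₂ = 0) (h3 : 2 * m₃ = 0 ∧ 2 * n₃ = 2) (h4 : 2 * m₄ = 2 ∧ 2 * n₄ = 0)
    (h5 : 2 * m₅ = 2 ∧ 2 * n₅ = 2)
    (ha₁ : a₁ = 1 + (⟨0, 1⟩ : GaussianInt) ^ m₂.val + (⟨0, 1⟩ : GaussianInt) ^ m₃.val + (⟨0, 1⟩ : GaussianInt) ^ m₄.val + (⟨0, 1⟩ : GaussianInt) ^ m₅.val)
    (ha₂ : a₂ = 1 + (⟨0, 1⟩ : GaussianInt) ^ (m₂ + 2 * n₂).val + (⟨0, 1⟩ : GaussianInt) ^ (m₃ + 2 * n₃).val + (⟨0, 1⟩ : GaussianInt) ^ (m₄ + 2 * n₄).val + (⟨0, 1⟩ : GaussianInt) ^ (m₅ + 2 * n₅).val)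
    (E1 : a₁ * b₁ + (⟨0, 1⟩ : GaussianInt) * star a₁ * b₁ + 1 * a₁ * star b₁ = -(⟨0, 1⟩ : GaussianInt) ^ l₁.val)
    (E2 : a₂ * b₂ + (⟨0, 1⟩ : GaussianInt) * star a₂ * b₂ + (-1) * a₂ * star b₂ = -(⟨0, 1⟩ : GaussianInt) ^ (l₁ + 2 * l₂).val) : False := by
  subst ha₁ ha₂
  rw [ipow_add_two_mul_of_eq_zero _ _ h2n₂, ipow_add_two_mul_of_eq_two _ _ h3.2, ipow_add_two_mul_of_eq_zero _ _ h4.2,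
    ipow_add_two_mul_of_eq_two _ _ h5.2] at E2
  rcases table5 m₂ m₃ m₄ m₅ l₁ l₂ h2m₂ h3.1 h4.1 h5.1 with hk | hk
  · exact false_of_kill5 (by simp) E1 hk
  · exact false_of_kill5 (by simp) E2 hk

/-! ## No shifted domino form with `|X| = 5` over `A ↠ ℤ₄²` -/

section Main

variable {A : Type*} [AddCommGroup A] [Fintype A] [DecidableEq A]

/-- **Core theorem.**  `A ↠ ZMod 4 × ZMod 4`; `X` of size `5`, `β, γ, x₀` with `X + Y` direct and
`(X+Y) ⊔ (β + (Y−X)) ⊔ (γ + (X−Y)) = A ∖ {x₀}`.  Then `False`. [folklore] -/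
theorem no_shifted_form_five_of_onto_z4z4 (φ : A →+ ZMod 4 × ZMod 4) (hφ : Function.Surjective φ)
    {X Y : Finset A} {β γ x₀ : A} (hX : X.card = 5)
    (hinj : Set.InjOn (fun p : A × A => p.1 + p.2) ↑(X ×ˢ Y))
    (hPQ : Disjoint ((X ×ˢ Y).image fun p : A × A => p.1 + p.2)
      (((Y ×ˢ X).image fun p : A × A => p.1 - p.2).image fun z => z + β))
    (hPR : Disjoint ((X ×ˢ Y).image fun p : A × A => p.1 + p.2)
      (((X ×ˢ Y).image fun p : A × A => p.1 - p.2).image fun z => z + γ))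
    (hQR : Disjoint (((Y ×ˢ X).image fun p : A × A => p.1 - p.2).image fun z => z + β)
      (((X ×ˢ Y).image fun p : A × A => p.1 - p.2).image fun z => z + γ))
    (hcover : ((X ×ˢ Y).image fun p : A × A => p.1 + p.2) ∪
      (((Y ×ˢ X).image fun p : A × A => p.1 - p.2).image fun z => z + β) ∪
      (((X ×ˢ Y).image fun p : A × A => p.1 - p.2).image fun z => z + γ) = univ.erase x₀) : False := by
  classical
  -- the pulled-back characters `ψ w a = i^⟨w, φ a⟩` as an opaque local function
  obtain ⟨ψ, hψ⟩ : ∃ ψ : ZMod 4 × ZMod 4 → A → GaussianInt,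
      ∀ w a, ψ w a = (⟨0, 1⟩ : GaussianInt) ^ (w.1 * (φ a).1 + w.2 * (φ a).2).val := ⟨_, fun _ _ => rfl⟩
  have hψadd : ∀ w a b, ψ w (a + b) = ψ w a * ψ w b := fun w a b => by
    rw [hψ, hψ, hψ]; exact z4char_add φ w a b
  have hψneg : ∀ w a, ψ w (-a) = star (ψ w a) := fun w a => by rw [hψ, hψ]; exact z4char_neg φ w a
  have hψsub : ∀ w a b, ψ w (a - b) = ψ w a * star (ψ w b) := fun w a b => by
    rw [sub_eq_add_neg, hψadd, hψneg]
  have hψsum : ∀ w, w ≠ 0 → ∑ a, ψ w a = 0 := fun w hw => by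
    simp only [hψ]; exact z4char_sum_eq_zero φ hφ w hw
  have hunit : ∀ w a, ψ w a * star (ψ w a) = 1 := fun w a => by
    have h := Zsqrtd.norm_eq_mul_conj (ψ w a)
    rw [hψ, norm_ipow] at h
    rw [hψ, ← h, Int.cast_one]
  -- the identity `(E_w)` for every `w ≠ 0`
  have E : ∀ w : ZMod 4 × ZMod 4, w ≠ 0 →
      (∑ x ∈ X, ψ w x) * (∑ v ∈ Y, ψ w v) + ψ w β * star (∑ x ∈ X, ψ w x) * (∑ v ∈ Y, ψ w v) +
        ψ w γ * (∑ x ∈ X, ψ w x) * star (∑ v ∈ Y, ψ w v) + ψ w x₀ = 0 := by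
    intro w hw
    have h := shifted_form_charsum (ψ w) (hψadd w) hinj hPQ hPR hQR hcover
    rw [hψsum w hw] at h
    simp only [hψneg] at h
    rw [star_sum, star_sum]
    linear_combination -h
  -- pigeonhole: two points of `X` in the same class mod `2`
  obtain ⟨x₁, hx₁, x₂, hx₂, hne12, hcl⟩ := exists_ne_map_eq_of_card_lt_of_maps_to
    (f := fun a : A => ((2 * (φ a).1, 2 * (φ a).2) : ZMod 4 × ZMod 4))
    (t := ({(0, 0), (0, 2), (2, 0), (2, 2)} : Finset (ZMod 4 × ZMod 4))) (by rw [hX]; decide)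
    (fun a _ => two_mul_pair_mem (φ a))
  -- the other three points
  have hx₂' : x₂ ∈ X.erase x₁ := mem_erase.2 ⟨hne12.symm, hx₂⟩
  have hX3 : ((X.erase x₁).erase x₂).card = 3 := by
    rw [card_erase_of_mem hx₂', card_erase_of_mem hx₁, hX]
  obtain ⟨y₃, y₄, y₅, h34, h35, h45, hX'⟩ := card_eq_three.1 hX3
  have hy₃ : y₃ ∈ (X.erase x₁).erase x₂ := by rw [hX']; simp
  have hy₄ : y₄ ∈ (X.erase x₁).erase x₂ := by rw [hX']; simp
  have hy₅ : y₅ ∈ (X.erase x₁).erase x₂ := by rw [hX']; simp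
  simp only [mem_erase] at hy₃ hy₄ hy₅
  have hXeq : X = insert x₁ (insert x₂ ({y₃, y₄, y₅} : Finset A)) := by
    rw [← hX', insert_erase hx₂', insert_erase hx₁]
  have hsumX : ∀ w, ∑ x ∈ X, ψ w x = ψ w x₁ + ψ w x₂ + ψ w y₃ + ψ w y₄ + ψ w y₅ := by
    intro w
    rw [hXeq, sum_insert, sum_insert, sum_insert, sum_pair h45]
    · ring
    · simp only [mem_insert, mem_singleton, not_or]; exact ⟨h34, h35⟩
    · simp only [mem_insert, mem_singleton, not_or]; exact ⟨Ne.symm hy₃.1, Ne.symm hy₄.1, Ne.symm hy₅.1⟩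
    · simp only [mem_insert, mem_singleton, not_or]
      exact ⟨hne12, Ne.symm hy₃.2.1, Ne.symm hy₄.2.1, Ne.symm hy₅.2.1⟩
  -- translated data
  obtain ⟨d₂, hd₂⟩ : ∃ d : A, d = x₂ - x₁ := ⟨_, rfl⟩
  obtain ⟨d₃, hd₃⟩ : ∃ d : A, d = y₃ - x₁ := ⟨_, rfl⟩
  obtain ⟨d₄, hd₄⟩ : ∃ d : A, d = y₄ - x₁ := ⟨_, rfl⟩
  obtain ⟨d₅, hd₅⟩ : ∃ d : A, d = y₅ - x₁ := ⟨_, rfl⟩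
  obtain ⟨β', hβ'⟩ : ∃ b : A, b = β - x₁ - x₁ := ⟨_, rfl⟩
  obtain ⟨e₀, he₀⟩ : ∃ e : A, e = x₀ - x₁ := ⟨_, rfl⟩
  have hsumX' : ∀ w, ∑ x ∈ X, ψ w x = ψ w x₁ * (1 + ψ w d₂ + ψ w d₃ + ψ w d₄ + ψ w d₅) := by
    intro w
    rw [hsumX, show x₂ = d₂ + x₁ by rw [hd₂]; abel, show y₃ = d₃ + x₁ by rw [hd₃]; abel,
      show y₄ = d₄ + x₁ by rw [hd₄]; abel, show y₅ = d₅ + x₁ by rw [hd₅]; abel, hψadd, hψadd, hψadd, hψadd]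
    ring
  -- `(E'_w)`: the identity after translating by `x₁`
  have E' : ∀ w : ZMod 4 × ZMod 4, w ≠ 0 →
      (1 + ψ w d₂ + ψ w d₃ + ψ w d₄ + ψ w d₅) * (∑ v ∈ Y, ψ w v) +
        ψ w β' * star (1 + ψ w d₂ + ψ w d₃ + ψ w d₄ + ψ w d₅) * (∑ v ∈ Y, ψ w v) +
        ψ w γ * (1 + ψ w d₂ + ψ w d₃ + ψ w d₄ + ψ w d₅) * star (∑ v ∈ Y, ψ w v) = -ψ w e₀ := by
    intro w hw
    have h := E w hw
    rw [hsumX' w, star_mul] at h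
    rw [hβ', he₀, hψsub, hψsub, hψsub]
    linear_combination (star (ψ w x₁)) * h -
      ((1 + ψ w d₂ + ψ w d₃ + ψ w d₄ + ψ w d₅) * (∑ v ∈ Y, ψ w v) +
        ψ w γ * (1 + ψ w d₂ + ψ w d₃ + ψ w d₄ + ψ w d₅) * star (∑ v ∈ Y, ψ w v)) * (hunit w x₁)
  -- `ψ_{2w}(d₂) = 1`
  have hcl1 : 2 * (φ d₂).1 = 0 := by
    have h1 := congrArg Prod.fst hcl
    simp only at h1
    rw [hd₂, map_sub, Prod.fst_sub, mul_sub, h1, sub_self]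
  have hcl2 : 2 * (φ d₂).2 = 0 := by
    have h1 := congrArg Prod.snd hcl
    simp only at h1
    rw [hd₂, map_sub, Prod.snd_sub, mul_sub, h1, sub_self]
  have htwo : ∀ w : ZMod 4 × ZMod 4, 2 * (w.1 * (φ d₂).1 + w.2 * (φ d₂).2) = 0 := fun w => by
    linear_combination w.1 * hcl1 + w.2 * hcl2
  have hd₂real : ∀ w : ZMod 4 × ZMod 4, ψ (w + w) d₂ = 1 := fun w => by
    rw [hψ, z4pair_two, htwo, ZMod.val_zero, pow_zero]
  -- real characters
  have hreal2 : ∀ w : ZMod 4 × ZMod 4, ∀ a, star (ψ (w + w) a) = ψ (w + w) a := fun w a => by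
    rw [hψ, z4pair_two, star_ipow_two_mul]
  have hrealY : ∀ w : ZMod 4 × ZMod 4, star (∑ v ∈ Y, ψ (w + w) v) = ∑ v ∈ Y, ψ (w + w) v := fun w => by
    rw [star_sum]; exact sum_congr rfl fun v _ => hreal2 w v
  have hpm : ∀ w : ZMod 4 × ZMod 4, ∀ a, ψ (w + w) a = 1 ∨ ψ (w + w) a = -1 := fun w a => by
    rw [hψ, z4pair_two]; exact ipow_two_mul_cases _
  -- (R2') `(ψβ', ψγ) ≠ (1,1)` for real `ψ`
  have R2 : ∀ w : ZMod 4 × ZMod 4, w + w ≠ 0 → ¬ (ψ (w + w) β' = 1 ∧ ψ (w + w) γ = 1) := by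
    rintro w hw ⟨h1, h2⟩
    have h := E' (w + w) hw
    rw [h1, h2, hrealY] at h
    simp only [star_add, star_one, hreal2] at h
    apply three_mul_ne_neg_ipow ((1 + ψ (w + w) d₂ + ψ (w + w) d₃ + ψ (w + w) d₄ + ψ (w + w) d₅) *
      ∑ v ∈ Y, ψ (w + w) v) ((w + w).1 * (φ e₀).1 + (w + w).2 * (φ e₀).2)
    rw [← hψ]; linear_combination h
  -- (R5) no two of `ψ d₃, ψ d₄, ψ d₅` equal `1` for real `ψ`
  have R5core : ∀ w : ZMod 4 × ZMod 4, w + w ≠ 0 → ∀ t : GaussianInt, (t = 1 ∨ t = -1) →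
      1 + ψ (w + w) d₂ + ψ (w + w) d₃ + ψ (w + w) d₄ + ψ (w + w) d₅ = 4 + t → False := by
    intro w hw t ht hs
    have h := E' (w + w) hw
    rw [hrealY] at h
    simp only [star_add, star_one, hreal2] at h
    rw [hs] at h
    obtain ⟨u, hu⟩ : ∃ u, ψ (w + w) β' = u := ⟨_, rfl⟩
    obtain ⟨v, hv⟩ : ∃ v, ψ (w + w) γ = v := ⟨_, rfl⟩
    rw [hu, hv] at h
    rcases ht with rfl | rfl
    · apply five_mul_ne_neg_ipow ((∑ x ∈ Y, ψ (w + w) x) * (1 + u + v))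
        ((w + w).1 * (φ e₀).1 + (w + w).2 * (φ e₀).2)
      rw [← hψ, ← h]
      ring
    · apply three_mul_ne_neg_ipow ((∑ x ∈ Y, ψ (w + w) x) * (1 + u + v))
        ((w + w).1 * (φ e₀).1 + (w + w).2 * (φ e₀).2)
      rw [← hψ, ← h]
      ring
  have R34 : ∀ w : ZMod 4 × ZMod 4, w + w ≠ 0 → ¬ (ψ (w + w) d₃ = 1 ∧ ψ (w + w) d₄ = 1) := by
    rintro w hw ⟨h1, h2⟩
    exact R5core w hw (ψ (w + w) d₅) (hpm w d₅) (by rw [hd₂real, h1, h2]; ring)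
  have R35 : ∀ w : ZMod 4 × ZMod 4, w + w ≠ 0 → ¬ (ψ (w + w) d₃ = 1 ∧ ψ (w + w) d₅ = 1) := by
    rintro w hw ⟨h1, h2⟩
    exact R5core w hw (ψ (w + w) d₄) (hpm w d₄) (by rw [hd₂real, h1, h2]; ring)
  have R45 : ∀ w : ZMod 4 × ZMod 4, w + w ≠ 0 → ¬ (ψ (w + w) d₄ = 1 ∧ ψ (w + w) d₅ = 1) := by
    rintro w hw ⟨h1, h2⟩
    exact R5core w hw (ψ (w + w) d₃) (hpm w d₃) (by rw [hd₂real, h1, h2]; ring)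
  -- coordinates `w, w'` dual to `(φ β', φ γ)`
  have e20 : ∀ q : ZMod 4 × ZMod 4, ((1, 0) + (1, 0) : ZMod 4 × ZMod 4).1 * q.1 +
      ((1, 0) + (1, 0) : ZMod 4 × ZMod 4).2 * q.2 = 2 * q.1 + 0 * q.2 := fun q => by
    simp only [Prod.mk_add_mk]; ring
  have e02 : ∀ q : ZMod 4 × ZMod 4, ((0, 1) + (0, 1) : ZMod 4 × ZMod 4).1 * q.1 +
      ((0, 1) + (0, 1) : ZMod 4 × ZMod 4).2 * q.2 = 0 * q.1 + 2 * q.2 := fun q => by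
    simp only [Prod.mk_add_mk]; ring
  have e22 : ∀ q : ZMod 4 × ZMod 4, ((1, 1) + (1, 1) : ZMod 4 × ZMod 4).1 * q.1 +
      ((1, 1) + (1, 1) : ZMod 4 × ZMod 4).2 * q.2 = 2 * q.1 + 2 * q.2 := fun q => by
    simp only [Prod.mk_add_mk]; ring
  have R2' : ∀ w : ZMod 4 × ZMod 4, w + w ≠ 0 →
      ¬ ((⟨0, 1⟩ : GaussianInt) ^ ((w + w).1 * (φ β').1 + (w + w).2 * (φ β').2).val = 1 ∧
         (⟨0, 1⟩ : GaussianInt) ^ ((w + w).1 * (φ γ).1 + (w + w).2 * (φ γ).2).val = 1) := by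
    intro w hw; rw [← hψ, ← hψ]; exact R2 w hw
  obtain ⟨w, w', hwP, hwQ, hw'P, hw'Q⟩ := exists_dual_pair (φ β') (φ γ)
    (by rw [← e20, ← e20]; exact R2' _ (by decide))
    (by rw [← e02, ← e02]; exact R2' _ (by decide))
    (by rw [← e22, ← e22]; exact R2' _ (by decide))
  have hw0 : w ≠ 0 := by
    rintro rfl
    simp only [Prod.fst_zero, Prod.snd_zero, zero_mul, add_zero] at hwP; exact absurd hwP (by decide)
  -- the second character `W₂ = w + 2w'`
  have hW₂P : (w + (w' + w')).1 * (φ β').1 + (w + (w' + w')).2 * (φ β').2 = 1 := by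
    rw [z4pair_add_left, z4pair_two, hwP, hw'P, mul_zero, add_zero]
  have hW₂Q : (w + (w' + w')).1 * (φ γ).1 + (w + (w' + w')).2 * (φ γ).2 = 2 := by
    rw [z4pair_add_left, z4pair_two, hwQ, hw'Q, mul_one, zero_add]
  have hW₂0 : w + (w' + w') ≠ 0 := by
    intro h; rw [h] at hW₂P
    simp only [Prod.fst_zero, Prod.snd_zero, zero_mul, add_zero] at hW₂P; exact absurd hW₂P (by decide)
  have hW₂pair : ∀ q : ZMod 4 × ZMod 4, (w + (w' + w')).1 * q.1 + (w + (w' + w')).2 * q.2 =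
      (w.1 * q.1 + w.2 * q.2) + 2 * (w'.1 * q.1 + w'.2 * q.2) := fun q => by
    rw [z4pair_add_left, z4pair_two]
  -- non-vanishing of the three real characters `2w, 2w', 2(w+w')`
  have h2w0 : w + w ≠ 0 := by
    intro h
    have := z4pair_two w (φ β')
    rw [h, hwP, mul_one] at this
    simp only [Prod.fst_zero, Prod.snd_zero, zero_mul, add_zero] at this; exact absurd this (by decide)
  have h2w'0 : w' + w' ≠ 0 := by
    intro h
    have := z4pair_two w' (φ γ)
    rw [h, hw'Q, mul_one] at this
    simp only [Prod.fst_zero, Prod.snd_zero, zero_mul, add_zero] at this; exact absurd this (by decide)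
  have h2ww'0 : (w + w') + (w + w') ≠ 0 := by
    intro h
    have := z4pair_two (w + w') (φ β')
    rw [h, z4pair_add_left, hwP, hw'P, add_zero, mul_one] at this
    simp only [Prod.fst_zero, Prod.snd_zero, zero_mul, add_zero] at this; exact absurd this (by decide)
  -- the nine pair exclusions in exponent form
  have hψ2 : ∀ (v : ZMod 4 × ZMod 4) (a : A),
      ψ (v + v) a = (⟨0, 1⟩ : GaussianInt) ^ (2 * (v.1 * (φ a).1 + v.2 * (φ a).2)).val := fun v a => by rw [hψ, z4pair_two]
  have hww' : ∀ a : A, (w + w').1 * (φ a).1 + (w + w').2 * (φ a).2 =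
      (w.1 * (φ a).1 + w.2 * (φ a).2) + (w'.1 * (φ a).1 + w'.2 * (φ a).2) := fun a => z4pair_add_left w w' (φ a)
  have P34 := R34 w h2w0; have P35 := R35 w h2w0; have P45 := R45 w h2w0
  have Q34 := R34 w' h2w'0; have Q35 := R35 w' h2w'0; have Q45 := R45 w' h2w'0
  have S34 := R34 (w + w') h2ww'0; have S35 := R35 (w + w') h2ww'0; have S45 := R45 (w + w') h2ww'0
  simp only [hψ2, hww'] at P34 P35 P45 Q34 Q35 Q45 S34 S35 S45
  -- the two identities in exponent form
  have E1 := E' w hw0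
  have E2 := E' (w + (w' + w')) hW₂0
  simp only [hψ] at E1 E2
  rw [hwP, hwQ, ipow_zmod_one, ipow_zmod_zero] at E1
  rw [hW₂P, hW₂Q, ipow_zmod_one, ipow_zmod_two, hW₂pair, hW₂pair, hW₂pair, hW₂pair, hW₂pair] at E2
  -- exponents
  set m₂ := w.1 * (φ d₂).1 + w.2 * (φ d₂).2 with hm₂
  set m₃ := w.1 * (φ d₃).1 + w.2 * (φ d₃).2 with hm₃
  set m₄ := w.1 * (φ d₄).1 + w.2 * (φ d₄).2 with hm₄
  set m₅ := w.1 * (φ d₅).1 + w.2 * (φ d₅).2 with hm₅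
  set n₂ := w'.1 * (φ d₂).1 + w'.2 * (φ d₂).2 with hn₂
  set n₃ := w'.1 * (φ d₃).1 + w'.2 * (φ d₃).2 with hn₃
  set n₄ := w'.1 * (φ d₄).1 + w'.2 * (φ d₄).2 with hn₄
  set n₅ := w'.1 * (φ d₅).1 + w'.2 * (φ d₅).2 with hn₅
  set l₁ := w.1 * (φ e₀).1 + w.2 * (φ e₀).2 with hl₁
  set l₂ := w'.1 * (φ e₀).1 + w'.2 * (φ e₀).2 with hl₂
  have h2m₂ : 2 * m₂ = 0 := htwo w
  have h2n₂ : 2 * n₂ = 0 := htwo w'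
  -- the parity pattern and the endgame
  rcases pattern5 m₃ n₃ m₄ n₄ m₅ n₅ P34 P35 P45 Q34 Q35 Q45 S34 S35 S45 with h | h | h | h | h | h
  · exact finish5 m₂ m₃ m₄ m₅ n₂ n₃ n₄ n₅ l₁ l₂ _ _ _ _ h2m₂ h2n₂ ⟨h.1, h.2.1⟩ ⟨h.2.2.1, h.2.2.2.1⟩ h.2.2.2.2
      (by ring) (by ring) E1 E2
  · exact finish5 m₂ m₃ m₅ m₄ n₂ n₃ n₅ n₄ l₁ l₂ _ _ _ _ h2m₂ h2n₂ ⟨h.1, h.2.1⟩ ⟨h.2.2.1, h.2.2.2.1⟩ h.2.2.2.2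
      (by ring) (by ring) E1 E2
  · exact finish5 m₂ m₄ m₃ m₅ n₂ n₄ n₃ n₅ l₁ l₂ _ _ _ _ h2m₂ h2n₂ ⟨h.1, h.2.1⟩ ⟨h.2.2.1, h.2.2.2.1⟩ h.2.2.2.2
      (by ring) (by ring) E1 E2
  · exact finish5 m₂ m₄ m₅ m₃ n₂ n₄ n₅ n₃ l₁ l₂ _ _ _ _ h2m₂ h2n₂ ⟨h.1, h.2.1⟩ ⟨h.2.2.1, h.2.2.2.1⟩ h.2.2.2.2
      (by ring) (by ring) E1 E2
  · exact finish5 m₂ m₅ m₃ m₄ n₂ n₅ n₃ n₄ l₁ l₂ _ _ _ _ h2m₂ h2n₂ ⟨h.1, h.2.1⟩ ⟨h.2.2.1, h.2.2.2.1⟩ h.2.2.2.2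
      (by ring) (by ring) E1 E2
  · exact finish5 m₂ m₅ m₄ m₃ n₂ n₅ n₄ n₃ l₁ l₂ _ _ _ _ h2m₂ h2n₂ ⟨h.1, h.2.1⟩ ⟨h.2.2.1, h.2.2.2.1⟩ h.2.2.2.2
      (by ring) (by ring) E1 E2

/-- **Core theorem, parts swapped**: the same with `|Y| = 5` (the identity is symmetric under `(X, β) ↔ (Y, γ)`).
[folklore] -/
theorem no_shifted_form_five_of_onto_z4z4' (φ : A →+ ZMod 4 × ZMod 4) (hφ : Function.Surjective φ)
    {X Y : Finset A} {β γ x₀ : A} (hY : Y.card = 5)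
    (hinj : Set.InjOn (fun p : A × A => p.1 + p.2) ↑(X ×ˢ Y))
    (hPQ : Disjoint ((X ×ˢ Y).image fun p : A × A => p.1 + p.2)
      (((Y ×ˢ X).image fun p : A × A => p.1 - p.2).image fun z => z + β))
    (hPR : Disjoint ((X ×ˢ Y).image fun p : A × A => p.1 + p.2)
      (((X ×ˢ Y).image fun p : A × A => p.1 - p.2).image fun z => z + γ))
    (hQR : Disjoint (((Y ×ˢ X).image fun p : A × A => p.1 - p.2).image fun z => z + β)
      (((X ×ˢ Y).image fun p : A × A => p.1 - p.2).image fun z => z + γ))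
    (hcover : ((X ×ˢ Y).image fun p : A × A => p.1 + p.2) ∪
      (((Y ×ˢ X).image fun p : A × A => p.1 - p.2).image fun z => z + β) ∪
      (((X ×ˢ Y).image fun p : A × A => p.1 - p.2).image fun z => z + γ) = univ.erase x₀) : False := by
  have himg := image_add_swap X Y
  refine no_shifted_form_five_of_onto_z4z4 φ hφ (X := Y) (Y := X) (β := γ) (γ := β) (x₀ := x₀) hY
    (injOn_add_swap hinj) ?_ ?_ hQR.symm ?_
  · rw [himg]; exact hPR
  · rw [himg]; exact hPQ
  · rw [himg, union_right_comm]; exact hcover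

end Main

/-! ## The TPP statements -/

section DihedralLike

variable {A : Type} [AddCommGroup A] [DecidableEq A] [Fintype A] {G : Type} [Group G] [DecidableEq G]
  {ρ τ : A → G} {c₀ : A} {S T U : Finset G}

open Literature.Combinatorics.Additive

/-- **No `(1,1 | 5,5 | e,e)` law triple over `A ↠ ℤ₄ × ℤ₄`.**  Dihedral-like `G` over `A` (any `c₀`), `φ : A →+ ZMod 4 × ZMod 4`
onto; a TPP triple whose coset parts have sizes `|S₀| = |S₁| = 1`, `|T₀| = |T₁| = 5`, `|U₀| = |U₁|`.  Then
`3|S||T||U| + 8 ≠ 8|A|`. [folklore] -/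
theorem no_law_cube_15e_of_onto_z4z4
    (hρρ : ∀ a b, ρ a * ρ b = ρ (a + b)) (hρτ : ∀ a b, ρ a * τ b = τ (b - a))
    (hτρ : ∀ a b, τ a * ρ b = τ (a + b)) (hττ : ∀ a b, τ a * τ b = ρ (c₀ + b - a))
    (hρ : Function.Injective ρ) (hτ : Function.Injective τ) (hne : ∀ a b, ρ a ≠ τ b)
    (hsurj : ∀ g, (∃ a, ρ a = g) ∨ (∃ a, τ a = g))
    (φ : A →+ ZMod 4 × ZMod 4) (hφ : Function.Surjective φ)
    (h : TripleProductProperty S T U)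
    (hS₀ : (univ.filter fun a : A => ρ a ∈ S).card = 1) (hS₁ : (univ.filter fun a : A => τ a ∈ S).card = 1)
    (hT₀ : (univ.filter fun a : A => ρ a ∈ T).card = 5) (hT₁ : (univ.filter fun a : A => τ a ∈ T).card = 5)
    (hU : (univ.filter fun a : A => ρ a ∈ U).card = (univ.filter fun a : A => τ a ∈ U).card)
    (hV : 3 * (S.card * T.card * U.card) + 8 = 8 * Fintype.card A) : False := by
  classical
  obtain ⟨X, Y, β, γ, x₀, hXc, -, hinj, hPQ, hPR, hQR, hcover⟩ :=
    domino_shifted_form_of_law hρρ hρτ hτρ hττ hρ hτ hne hsurj h hS₀ hS₁ (by rw [hT₀, hT₁]) hU hV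
  rw [hT₀] at hXc
  exact no_shifted_form_five_of_onto_z4z4 φ hφ hXc hinj hPQ hPR hQR hcover

/-- **No `(1,1 | d,d | 5,5)` law triple over `A ↠ ℤ₄ × ℤ₄`** (the size-`5` parts in `U`). [folklore] -/
theorem no_law_cube_1d5_of_onto_z4z4
    (hρρ : ∀ a b, ρ a * ρ b = ρ (a + b)) (hρτ : ∀ a b, ρ a * τ b = τ (b - a))
    (hτρ : ∀ a b, τ a * ρ b = τ (a + b)) (hττ : ∀ a b, τ a * τ b = ρ (c₀ + b - a))
    (hρ : Function.Injective ρ) (hτ : Function.Injective τ) (hne : ∀ a b, ρ a ≠ τ b)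
    (hsurj : ∀ g, (∃ a, ρ a = g) ∨ (∃ a, τ a = g))
    (φ : A →+ ZMod 4 × ZMod 4) (hφ : Function.Surjective φ)
    (h : TripleProductProperty S T U)
    (hS₀ : (univ.filter fun a : A => ρ a ∈ S).card = 1) (hS₁ : (univ.filter fun a : A => τ a ∈ S).card = 1)
    (hT : (univ.filter fun a : A => ρ a ∈ T).card = (univ.filter fun a : A => τ a ∈ T).card)
    (hU₀ : (univ.filter fun a : A => ρ a ∈ U).card = 5) (hU₁ : (univ.filter fun a : A => τ a ∈ U).card = 5)
    (hV : 3 * (S.card * T.card * U.card) + 8 = 8 * Fintype.card A) : False := by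
  classical
  obtain ⟨X, Y, β, γ, x₀, -, hYc, hinj, hPQ, hPR, hQR, hcover⟩ :=
    domino_shifted_form_of_law hρρ hρτ hτρ hττ hρ hτ hne hsurj h hS₀ hS₁ hT (by rw [hU₀, hU₁]) hV
  rw [hU₀] at hYc
  exact no_shifted_form_five_of_onto_z4z4' φ hφ hYc hinj hPQ hPR hQR hcover

end DihedralLike

end Summit.MatrixMultiplication.OmegaCensus
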